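import Summits.CriticalPhenomena.PercolationContinuityZ3.Theorems.PercNearOneGluingNoHeavyLowerTailThreePointProductFormABPlus
import Summits.CriticalPhenomena.PercolationContinuityZ3.Theorems.PercNearOneGluingNoHeavyLowerTailThreePointProductFormCorners

/-!
# The Krein (reversal) form of the AM-form series: `A[u ++ w] = β(state(reverse u), state(w))`
# (Sahi programme, one-child boundary-star cycle, prover prim-sahi-p2 gen 66)

Support file (`--supports stmt-CriticalPhenomena-4575`).  Standard axioms, no sorries, no named facts.  Memo
`run/shared/lean/prim/prim-sahi/FROM-prim-sahi-p2-gen66-*.md`, `prim-sahi-p2/PROOF-E3.md` §76.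

THE OBJECT.  `…ThreePointProductFormABPlus` realises the AM form `A = #P1 + #P2 − 2·#bad` of the one-child boundary-star
cycle as the 12-state rational series `coeff w = alphaA (evalA w) + alphaB (evalB w)` over the site letters `p = s², q = d², r = sd`
(normal form of gen 64: an 8-state part `StA` and a 4-state part `StB`).  Gen 65 found (exactly, `lab65/data/T_reversal.json`)
a symmetric nondegenerate matrix `T` (signature `(6,6)`) with `Mᵀ_x T = T M_x` for the three letters and `T ω = αᵀ`.
This file makes that a theorem of the Lean automaton and draws the consequences used by every "two-sided" argument of
the box programme (gen 66 memo §1):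

* `kA`, `kB` — the Krein form `β = T` on the two parts (explicit rational bilinear forms; on the `U`-blocks it is the tensor
  product of the Hankel form `[[3/4,37/16],[37/16,435/64]]` of the module `U` with the copy-space form
  `[[375,−375/4],[−375/4,−5625/16]]`, on `(o₁,o₂)` the copy-space form, on `(f₁,f₂)` `300·`Hankel, on `E5` `300`, on `E4` `−12`);
* `kA_symm`, `kA_stepA` (every letter is `β`-selfadjoint: `β(M_x v, w) = β(v, M_x w)`), `kA_omegaA` (`β(ω, ·) = α`), and the
  same for the `b`-part;
* `runA/runB` (a word acting on an arbitrary state), `evalA_eq_runA`, `runA_append`, and the adjointness of whole words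
  `kA_runA : β(N_u v, w) = β(v, N_{reverse u} w)`;
* ★ `coeff_append : coeff (u ++ w) = kA (evalA u.reverse) (evalA w) + kB (evalB u.reverse) (evalB w)` — the value of the
  series on a concatenated word is the Krein pairing of the two half-word states ("split the cycle word anywhere");
* `coeff_reverse : coeff w.reverse = coeff w` (reversal symmetry of the series) and the diagonal form
  `coeff_reverse_append : coeff (u.reverse ++ u) = kA (evalA u) (evalA u) + kB (evalB u) (evalB u)`.
* §2 THE TENSOR COORDINATES (gen 66 memo §1): the nine middle states are `𝕄 ⊗ ℝ³` for the 3-dimensional module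
  `𝕄 = ⟨e1, e2, y⟩` of `…ProductFormCorners` (`V3`; letters `actP/actQ/actR`).  In the copy basis `n₊ = 5c₁ + 4c₂`,
  `n₋ = 3c₁ − 4c₂` (the two NULL vectors of the copy-space form) the columns are `colP v = (4·col₁ + 3·col₂)/32`,
  `colM v = (4·col₁ − 5·col₂)/32`, `col3`; with the LEAK COORDINATE `Lam v = ℓ₀ + (7/3)·ψ₊(col₁)` (`ψ₊ = (4,3,0)`):
  - `alphaA_coords : α_a(v) = (27/8)t − (45/14)Λ − 15·ψ₂₃(m₋)` (`ψ₂₃ = (4,23,0)`): the final functional does not see `m₊`;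
  - `kA_coords : β_a(v,w) = (81/64)tt' − (135/112)(tΛ' + Λt') − (45/8)(t·ψ₂₃(m'₋) + t'·ψ₂₃(m₋))
      + 12000·[β𝕄(m₊,m'₋) + β𝕄(m₋,m'₊)]`, `kB_coords : β_b = 300·β𝕄(m³,m'³) − 12·E4·E4'`
    (`betaM` = the Hankel form `[[3/4,37/16,0],[37/16,435/64,0],[0,0,1]]` of `𝕄`): `m₊` pairs ONLY with `m'₋` — the
    structural reason for the Perron cancellation of THEOREM A (hub words have `m₋ = 0`);
  - the dynamics: `colP_stepA/colM_stepA/col3_stepB` (each column moves by the SAME letter of `𝕄` plus a jump `∝ t`: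
    `J₊ = (−3/3200)(1,4,0)·p + (−3/1600,0,0)·q + (0,0,−3/640)·r`, `J₋ = (−13/640,1/160,0)·q + (0,0,−3/640)·r`, none for
    `col3`), `Lam_stepA` (`Λ ↦ (3/4)Λ − (7/40)t` under `p`, `(1/4)Λ − (7/24)t + (7/18)ψ₂₃(col₁)` under `q`, `(28/3)(col₁)_y`
    under `r`), `t_stepA`, `E4_stepB`.
[this work] (gen 66).
-/

namespace Summit.CriticalPhenomena.PercolationContinuityZ3.Theorems.ProductFormABPlus

/-- The Krein (reversal) form `β = T` on the 8-state `a`-part (gen 65 `T_reversal.json`, rows/columns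
`t, ℓ₀, e₁′, e₂′, e₁″, e₂″, o₁, o₂`). [this work] -/
def kA (v w : StA) : ℚ :=
  (81/64 : ℚ) * v.t * w.t +
    (-135/112 : ℚ) * v.t * w.l0 +
    (-225/16 : ℚ) * v.t * w.e1a +
    (-1575/64 : ℚ) * v.t * w.e2a +
    (225/64 : ℚ) * v.t * w.e1b +
    (5175/256 : ℚ) * v.t * w.e2b +
    (-135/112 : ℚ) * v.l0 * w.t +
    (-225/16 : ℚ) * v.e1a * w.t +
    (1125/4 : ℚ) * v.e1a * w.e1a +
    (13875/16 : ℚ) * v.e1a * w.e2a +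
    (-1125/16 : ℚ) * v.e1a * w.e1b +
    (-13875/64 : ℚ) * v.e1a * w.e2b +
    (-1575/64 : ℚ) * v.e2a * w.t +
    (13875/16 : ℚ) * v.e2a * w.e1a +
    (163125/64 : ℚ) * v.e2a * w.e2a +
    (-13875/64 : ℚ) * v.e2a * w.e1b +
    (-163125/256 : ℚ) * v.e2a * w.e2b +
    (225/64 : ℚ) * v.e1b * w.t +
    (-1125/16 : ℚ) * v.e1b * w.e1a +
    (-13875/64 : ℚ) * v.e1b * w.e2a +
    (-16875/64 : ℚ) * v.e1b * w.e1b +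
    (-208125/256 : ℚ) * v.e1b * w.e2b +
    (5175/256 : ℚ) * v.e2b * w.t +
    (-13875/64 : ℚ) * v.e2b * w.e1a +
    (-163125/256 : ℚ) * v.e2b * w.e2a +
    (-208125/256 : ℚ) * v.e2b * w.e1b +
    (-2446875/1024 : ℚ) * v.e2b * w.e2b +
    (375 : ℚ) * v.o1 * w.o1 +
    (-375/4 : ℚ) * v.o1 * w.o2 +
    (-375/4 : ℚ) * v.o2 * w.o1 +
    (-5625/16 : ℚ) * v.o2 * w.o2

/-- The Krein form on the 4-state `b`-part (`E5, E4, f₁, f₂`). [this work] -/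
def kB (v w : StB) : ℚ :=
  (300 : ℚ) * v.E5 * w.E5 +
    (-12 : ℚ) * v.E4 * w.E4 +
    (225 : ℚ) * v.f1 * w.f1 +
    (2775/4 : ℚ) * v.f1 * w.f2 +
    (2775/4 : ℚ) * v.f2 * w.f1 +
    (32625/16 : ℚ) * v.f2 * w.f2

/-- `β` is symmetric on the `a`-part. [this work] -/
theorem kA_symm (v w : StA) : kA v w = kA w v := by
  unfold kA; ring

/-- `β` is symmetric on the `b`-part. [this work] -/
theorem kB_symm (v w : StB) : kB v w = kB w v := by
  unfold kB; ring

/-- Every letter is `β`-selfadjoint on the `a`-part: `β(M_x v, w) = β(v, M_x w)` (`Mᵀ_x T = T M_x`). [this work] -/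
theorem kA_stepA (x : Letter) (v w : StA) : kA (stepA x v) w = kA v (stepA x w) := by
  cases x <;> simp only [kA, stepA] <;> ring

/-- Every letter is `β`-selfadjoint on the `b`-part. [this work] -/
theorem kB_stepB (x : Letter) (v w : StB) : kB (stepB x v) w = kB v (stepB x w) := by
  cases x <;> simp only [kB, stepB] <;> ring

/-- `β(ω_a, v) = α_a(v)` (`T ω = αᵀ` on the `a`-part). [this work] -/
theorem kA_omegaA (v : StA) : kA omegaA v = alphaA v := by
  simp only [kA, omegaA, alphaA]; ring

/-- `β(ω_b, v) = α_b(v)` (`T ω = αᵀ` on the `b`-part). [this work] -/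
theorem kB_omegaB (v : StB) : kB omegaB v = alphaB v := by
  simp only [kB, omegaB, alphaB]; ring

/-- The action of a word on an arbitrary `a`-state (leftmost letter acts last). [this work] -/
def runA : List Letter → StA → StA
  | [], v => v
  | x :: u, v => stepA x (runA u v)

/-- The action of a word on an arbitrary `b`-state. [this work] -/
def runB : List Letter → StB → StB
  | [], v => v
  | x :: u, v => stepB x (runB u v)

/-- `evalA w = N_w ω_a`. [this work] -/
theorem evalA_eq_runA (w : List Letter) : evalA w = runA w omegaA := by
  induction w with
  | nil => rfl
  | cons x u ih => simp only [evalA, runA, ih]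

/-- `evalB w = N_w ω_b`. [this work] -/
theorem evalB_eq_runB (w : List Letter) : evalB w = runB w omegaB := by
  induction w with
  | nil => rfl
  | cons x u ih => simp only [evalB, runB, ih]

/-- `N_{u ++ w} = N_u ∘ N_w` on the `a`-part. [this work] -/
theorem runA_append (u w : List Letter) (v : StA) : runA (u ++ w) v = runA u (runA w v) := by
  induction u with
  | nil => rfl
  | cons x u ih => simp only [List.cons_append, runA, ih]

/-- `N_{u ++ w} = N_u ∘ N_w` on the `b`-part. [this work] -/
theorem runB_append (u w : List Letter) (v : StB) : runB (u ++ w) v = runB u (runB w v) := by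
  induction u with
  | nil => rfl
  | cons x u ih => simp only [List.cons_append, runB, ih]

/-- Whole words are `β`-adjoint to their reversals: `β(N_u v, w) = β(v, N_{reverse u} w)` (`a`-part). [this work] -/
theorem kA_runA (u : List Letter) (v w : StA) : kA (runA u v) w = kA v (runA u.reverse w) := by
  induction u generalizing v w with
  | nil => rfl
  | cons x u ih =>
    simp only [runA, List.reverse_cons, runA_append]
    rw [kA_stepA, ih]

/-- Whole words are `β`-adjoint to their reversals (`b`-part). [this work] -/
theorem kB_runB (u : List Letter) (v w : StB) : kB (runB u v) w = kB v (runB u.reverse w) := by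
  induction u generalizing v w with
  | nil => rfl
  | cons x u ih =>
    simp only [runB, List.reverse_cons, runB_append]
    rw [kB_stepB, ih]

/-- `A_a[u ++ w] = β(N_{reverse u} ω_a, N_w ω_a)`. [this work] -/
theorem coeffA_append (u w : List Letter) : coeffA (u ++ w) = kA (evalA u.reverse) (evalA w) := by
  unfold coeffA
  rw [evalA_eq_runA, evalA_eq_runA, evalA_eq_runA, runA_append, ← kA_omegaA, kA_symm, kA_runA]
  exact kA_symm _ _

/-- `A_b[u ++ w] = β(N_{reverse u} ω_b, N_w ω_b)`. [this work] -/
theorem coeffB_append (u w : List Letter) : coeffB (u ++ w) = kB (evalB u.reverse) (evalB w) := by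
  unfold coeffB
  rw [evalB_eq_runB, evalB_eq_runB, evalB_eq_runB, runB_append, ← kB_omegaB, kB_symm, kB_runB]
  exact kB_symm _ _

/-- ★ THE PAIR IDENTITY.  For all words `u, w`: `A[u ++ w] = β(state(reverse u), state(w))` — the coefficient of the
AM-form series on a concatenated word is the Krein pairing of the two half-word states. [this work] -/
theorem coeff_append (u w : List Letter) :
    coeff (u ++ w) = kA (evalA u.reverse) (evalA w) + kB (evalB u.reverse) (evalB w) := by
  unfold coeff; rw [coeffA_append, coeffB_append]

/-- Reversal symmetry of the series: `A[reverse w] = A[w]`. [this work] -/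
theorem coeff_reverse (w : List Letter) : coeff w.reverse = coeff w := by
  have h := coeff_append w.reverse []
  rw [List.append_nil, List.reverse_reverse] at h
  rw [h]
  unfold coeff coeffA coeffB
  rw [kA_symm, kB_symm]
  show kA (evalA []) (evalA w) + kB (evalB []) (evalB w) = _
  simp only [evalA, evalB, kA_omegaA, kB_omegaB]

/-- The diagonal form: `A[reverse u ++ u] = β(state u, state u)`. [this work] -/
theorem coeff_reverse_append (u : List Letter) :
    coeff (u.reverse ++ u) = kA (evalA u) (evalA u) + kB (evalB u) (evalB u) := by
  rw [coeff_append, List.reverse_reverse]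

/-! ### 2. Tensor coordinates: `t → 𝕄 ⊗ {n₊, n₋, c₃} → Λ`, and the pair form in these coordinates -/

open ProductFormCorners (V3)

/-- The letter `p` on the module `𝕄 = ⟨e1,e2,y⟩` (column action: `e1 ↦ e2`, `e2 ↦ −(5/2)e1 + (15/4)e2`, `y ↦ (5/4)y`). [this work] -/
def actP (a : V3) : V3 := ⟨-(5/2) * a.y, a.x + (15/4) * a.y, (5/4) * a.z⟩

/-- The letter `q` on `𝕄` (`e1 ↦ (3/4)e1`, `e2 ↦ (37/16)e1`, `y ↦ (1/4)y`). [this work] -/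
def actQ (a : V3) : V3 := ⟨(3/4) * a.x + (37/16) * a.y, 0, (1/4) * a.z⟩

/-- The letter `r` on `𝕄` (`e1 ↦ (3/4)y`, `e2 ↦ (37/16)y`, `y ↦ e1`). [this work] -/
def actR (a : V3) : V3 := ⟨a.z, 0, (3/4) * a.x + (37/16) * a.y⟩

/-- The action of a letter on `𝕄`. [this work] -/
def act : Letter → V3 → V3
  | .p => actP
  | .q => actQ
  | .r => actR

/-- The `n₊`-column `m₊ = (4·col₁ + 3·col₂)/32` of an `a`-state (`col₁ = (e₁′,e₂′,o₁)`, `col₂ = (e₁″,e₂″,o₂)`). [this work] -/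
def colP (v : StA) : V3 :=
  ⟨(4 * v.e1a + 3 * v.e1b) / 32, (4 * v.e2a + 3 * v.e2b) / 32, (4 * v.o1 + 3 * v.o2) / 32⟩

/-- The `n₋`-column `m₋ = (4·col₁ − 5·col₂)/32` of an `a`-state. [this work] -/
def colM (v : StA) : V3 :=
  ⟨(4 * v.e1a - 5 * v.e1b) / 32, (4 * v.e2a - 5 * v.e2b) / 32, (4 * v.o1 - 5 * v.o2) / 32⟩

/-- The third column `m³ = (f₁, f₂, E5)` of a `b`-state. [this work] -/
def col3 (v : StB) : V3 := ⟨v.f1, v.f2, v.E5⟩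

/-- The leak coordinate `Λ = ℓ₀ + (7/3)·ψ₊(col₁)`, `ψ₊ = (4,3,0)`. [this work] -/
def Lam (v : StA) : ℚ := v.l0 + (28/3) * v.e1a + 7 * v.e2a

/-- The functional `ψ₂₃ = (4, 23, 0)` on `𝕄`. [this work] -/
def psi23 (a : V3) : ℚ := 4 * a.x + 23 * a.y

/-- The Krein form of the module `𝕄`: the Hankel form `[[3/4,37/16],[37/16,435/64]] ⊕ 1`. [this work] -/
def betaM (a b : V3) : ℚ :=
  (3/4) * a.x * b.x + (37/16) * (a.x * b.y + a.y * b.x) + (435/64) * a.y * b.y + a.z * b.z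

/-- `β𝕄` is symmetric. [this work] -/
theorem betaM_symm (a b : V3) : betaM a b = betaM b a := by unfold betaM; ring

/-- Every letter of `𝕄` is `β𝕄`-selfadjoint. [this work] -/
theorem betaM_act (x : Letter) (a b : V3) : betaM (act x a) b = betaM a (act x b) := by
  cases x <;> simp only [act, actP, actQ, actR, betaM] <;> ring

/-- The jump of the `n₊`-column under a letter (`∝ t`). [this work] -/
def jumpP : Letter → V3
  | .p => ⟨-(3/3200), -(12/3200), 0⟩
  | .q => ⟨-(3/1600), 0, 0⟩
  | .r => ⟨0, 0, -(3/640)⟩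

/-- The jump of the `n₋`-column under a letter (`∝ t`; none under `p`). [this work] -/
def jumpM : Letter → V3
  | .p => ⟨0, 0, 0⟩
  | .q => ⟨-(13/640), 1/160, 0⟩
  | .r => ⟨0, 0, -(3/640)⟩

/-- `m₊` moves by the letter of `𝕄` plus `t`·jump. [this work] -/
theorem colP_stepA (x : Letter) (v : StA) :
    colP (stepA x v) = ⟨(act x (colP v)).x + v.t * (jumpP x).x, (act x (colP v)).y + v.t * (jumpP x).y,
      (act x (colP v)).z + v.t * (jumpP x).z⟩ := by
  cases x <;> simp only [colP, stepA, act, actP, actQ, actR, jumpP] <;> (ext <;> simp <;> ring)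

/-- `m₋` moves by the letter of `𝕄` plus `t`·jump (no jump under the hub letter `p`). [this work] -/
theorem colM_stepA (x : Letter) (v : StA) :
    colM (stepA x v) = ⟨(act x (colM v)).x + v.t * (jumpM x).x, (act x (colM v)).y + v.t * (jumpM x).y,
      (act x (colM v)).z + v.t * (jumpM x).z⟩ := by
  cases x <;> simp only [colM, stepA, act, actP, actQ, actR, jumpM] <;> (ext <;> simp <;> ring)

/-- `m³` moves by the letter of `𝕄` (no jump). [this work] -/
theorem col3_stepB (x : Letter) (v : StB) : col3 (stepB x v) = act x (col3 v) := by
  cases x <;> simp only [col3, stepB, act, actP, actQ, actR]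

/-- The top state `t` is a character: `(3/4, 1/4, 0)`. [this work] -/
theorem t_stepA (x : Letter) (v : StA) :
    (stepA x v).t = (match x with | .p => (3/4 : ℚ) | .q => 1/4 | .r => 0) * v.t := by
  cases x <;> simp [stepA]

/-- `E4` is the character `(1, 0, 0)`. [this work] -/
theorem E4_stepB (x : Letter) (v : StB) :
    (stepB x v).E4 = (match x with | .p => (1 : ℚ) | .q => 0 | .r => 0) * v.E4 := by
  cases x <;> simp [stepB]

/-- The leak coordinate under the three letters: `Λ ↦ (3/4)Λ − (7/40)t` (`p`), `(1/4)Λ − (7/24)t + (7/18)ψ₂₃(col₁)` (`q`),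
`(28/3)·(col₁)_y` (`r`), where `col₁ = 5m₊ + 3m₋ = (e₁′, e₂′, o₁)`. [this work] -/
theorem Lam_stepA (x : Letter) (v : StA) :
    Lam (stepA x v) = (match x with
      | .p => (3/4) * Lam v - (7/40) * v.t
      | .q => (1/4) * Lam v - (7/24) * v.t + (7/18) * (4 * v.e1a + 23 * v.e2a)
      | .r => (28/3) * v.o1) := by
  cases x <;> simp only [Lam, stepA] <;> ring

/-- `col₁ = 5·m₊ + 3·m₋` (so the leak reads `5m₊ + 3m₋`). [this work] -/
theorem col1_eq (v : StA) :
    (⟨v.e1a, v.e2a, v.o1⟩ : V3) = ⟨5 * (colP v).x + 3 * (colM v).x, 5 * (colP v).y + 3 * (colM v).y,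
      5 * (colP v).z + 3 * (colM v).z⟩ := by
  ext <;> simp [colP, colM] <;> ring

/-- ★ The final functional in tensor coordinates: `α_a(v) = (27/8)·t − (45/14)·Λ − 15·ψ₂₃(m₋)` — it does not see `m₊`. [this work] -/
theorem alphaA_coords (v : StA) : alphaA v = (27/8) * v.t - (45/14) * Lam v - 15 * psi23 (colM v) := by
  simp only [alphaA, Lam, psi23, colM]; ring

/-- `α_b(v) = −30·(m³)_y − 12·E4`. [this work] -/
theorem alphaB_coords (v : StB) : alphaB v = -30 * (col3 v).z - 12 * v.E4 := by
  simp only [alphaB, col3]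

/-- ★ The Krein form in tensor coordinates (`a`-part): `m₊` pairs only with `m'₋`.
`β_a(v,w) = (81/64)tt' − (135/112)(t·Λ' + Λ·t') − (45/8)(t·ψ₂₃(m'₋) + t'·ψ₂₃(m₋)) + 12000·[β𝕄(m₊,m'₋) + β𝕄(m₋,m'₊)]`. [this work] -/
theorem kA_coords (v w : StA) :
    kA v w = (81/64) * v.t * w.t - (135/112) * (v.t * Lam w + Lam v * w.t)
      - (45/8) * (v.t * psi23 (colM w) + w.t * psi23 (colM v))
      + 12000 * (betaM (colP v) (colM w) + betaM (colM v) (colP w)) := by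
  simp only [kA, Lam, psi23, colP, colM, betaM]; ring

/-- The Krein form in tensor coordinates (`b`-part): `β_b(v,w) = 300·β𝕄(m³,m'³) − 12·E4·E4'`. [this work] -/
theorem kB_coords (v w : StB) : kB v w = 300 * betaM (col3 v) (col3 w) - 12 * v.E4 * w.E4 := by
  simp only [kB, col3, betaM]; ring

/-- ★ THE PAIR IDENTITY in tensor coordinates: for all words `u, w`, with `v = state(reverse u)`, `v' = state(w)`,
`A[u ++ w] = (81/64)tt' − (135/112)(tΛ' + Λt') − (45/8)(t·ψ₂₃(m'₋) + t'·ψ₂₃(m₋)) + 12000[β𝕄(m₊,m'₋) + β𝕄(m₋,m'₊)]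
  + 300·β𝕄(m³,m'³) − 12·E4·E4'`. [this work] -/
theorem coeff_append_coords (u w : List Letter) :
    coeff (u ++ w) =
      (81/64) * (evalA u.reverse).t * (evalA w).t
      - (135/112) * ((evalA u.reverse).t * Lam (evalA w) + Lam (evalA u.reverse) * (evalA w).t)
      - (45/8) * ((evalA u.reverse).t * psi23 (colM (evalA w)) + (evalA w).t * psi23 (colM (evalA u.reverse)))
      + 12000 * (betaM (colP (evalA u.reverse)) (colM (evalA w)) + betaM (colM (evalA u.reverse)) (colP (evalA w)))
      + (300 * betaM (col3 (evalB u.reverse)) (col3 (evalB w)) - 12 * (evalB u.reverse).E4 * (evalB w).E4) := by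
  rw [coeff_append, kA_coords, kB_coords]


end Summit.CriticalPhenomena.PercolationContinuityZ3.Theorems.ProductFormABPlus
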